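import Summits.Ventures.YMGap.Census.CubeMerge
import HarnessLib

/-!
# Venture YMGap, track (b) — the unit-cube partition function `Z_cube({c_j}) = 1 + Σ_j d_j² c_j⁶` EXACTLY, for every
# spin cut-off (Tomboulis, arXiv:0707.2179, App. A eq. (A.5): the one-hypercube number of Prop. II.1 (ii))

HONEST FRAMING: venture file of the cell `pub-ymgap` (QuantumFields programme), track (b); an exact finite Haar integral
over the twelve links of a unit 3-cube of the torus `(ℤ/Lℤ)^d` (`1 < L`); nothing about (5.15), limits, confinement or a
mass gap.

`cubeFn J c i j k b` is the product of Tomboulis's plaquette functions `f_c(U_p) = 1 + Σ_{j≠0} d_j c_j χ_j(U_p)` (spin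
cut-off `2j ≤ J`) over the six faces of the unit cube with base `b` spanned by the directions `i < j < k`, and
`cubeZ = ∫ cubeFn ∏_b dU_b`.  **`cubeZ_eq`**: `cubeZ = 1 + Σ_{n=1}^{J} (n+1)² c_n⁶` — the character expansion of the cube
(a sphere with `F = 6`: `Σ_j (d_j c_j)^6 d_j^{2-6}`).  Proof: five face mergings (`CubeMerge.integral_faceSum_merge`,
the convolution identity `∫ χ_m(AV) χ_n(V⁻¹B) dV = [m=n] χ_n(AB)/(n+1)` of the venture `LatticeQCDFlow`) along the links
`(b,i)`, `(b,j)`, `(b+e_j+e_k, i)`, `(b+e_i+e_k, j)`, `(b+e_i, j)`; the two three-face caps around the corners `b` and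
`b+e_i+e_j+e_k` both contract to the same equatorial hexagon (two links cancel algebraically), and the last merging glues
the hexagon to its inverse, leaving `χ_n(1) = n+1`.  No `6j` input is needed.

## Main statements (namespace `Summit.Ventures.YMGap.Census`)

* `cubeFn`, `cubeZ`; **`cubeZ_eq`** (`i < j < k`, `1 < L`, every `J`, every coefficient sequence `c`).

References: E. T. Tomboulis, arXiv:0707.2179, App. A §1 eq. (A.5) [cite: Tomboulis2007Confinement, App. A eq. (A.5)];
J.-M. Drouffe, J.-B. Zuber, Phys. Rept. 102 (1983) 1, §3.1 [folklore].
-/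

noncomputable section

open MeasureTheory Finset Real Function Polynomial.Chebyshev
open scoped BigOperators
open Literature.MathematicalPhysics.QuantumLattice
open Literature.MathematicalPhysics.QuantumFieldTheory
open Literature.MathematicalPhysics.QuantumFieldTheory.Tomboulis2007
open Literature.MathematicalPhysics.QuantumFieldTheory.WilsonRP
open Summit.Ventures.LatticeQCDFlow.Exactness
open Summit.Ventures.LatticeQCDFlow.Scoring

namespace Summit.Ventures.YMGap.Census

variable {d L : ℕ}

section Cube

variable [NeZero L] (J : ℕ) (c : ℕ → ℝ) (i j k : Fin d) (b : Site d L)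

/-- **The unit-cube weight**: the product of the plaquette functions over the six faces of the unit cube with base `b`
spanned by `i < j < k` (faces `(b;i,j)`, `(b+e_k;i,j)`, `(b;i,k)`, `(b+e_j;i,k)`, `(b;j,k)`, `(b+e_i;j,k)`). -/
def cubeFn (hij : i < j) (hik : i < k) (hjk : j < k) (W : GaugeConfig d L SU2) : ℝ :=
  fR J c (plaqRe rhoFund W (b, ⟨(i, j), hij⟩)) * fR J c (plaqRe rhoFund W (b.shift k, ⟨(i, j), hij⟩)) *
    fR J c (plaqRe rhoFund W (b, ⟨(i, k), hik⟩)) * fR J c (plaqRe rhoFund W (b.shift j, ⟨(i, k), hik⟩)) *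
    fR J c (plaqRe rhoFund W (b, ⟨(j, k), hjk⟩)) * fR J c (plaqRe rhoFund W (b.shift i, ⟨(j, k), hjk⟩))

/-- **The unit-cube partition function** `Z_cube = ∫ ∏_{p ∈ cube} f_c(U_p) ∏_b dU_b`. -/
def cubeZ (hij : i < j) (hik : i < k) (hjk : j < k) : ℝ :=
  ∫ W, cubeFn J c i j k b hij hik hjk W ∂(Measure.pi fun _ : Edge d L => haarProbability SU2)

/-! #### The words of the five mergings (`Lμxy = W(b + x e + y e', μ)`) -/

/-- `β₁ = Lj10 Li10⁻¹ Lj00⁻¹`. -/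
def wB1 (W : GaugeConfig d L SU2) : SU2 := W (b.shift i, j) * (W (b.shift j, i))⁻¹ * (W (b, j))⁻¹
/-- `γ₁ = Lk00 Li01 Lk10⁻¹`. -/
def wG1 (W : GaugeConfig d L SU2) : SU2 := W (b, k) * W (b.shift k, i) * (W (b.shift i, k))⁻¹
/-- `β₂ = Lk01 Lj01⁻¹ Lk00⁻¹`. -/
def wB2 (W : GaugeConfig d L SU2) : SU2 := W (b.shift j, k) * (W (b.shift k, j))⁻¹ * (W (b, k))⁻¹
/-- `γ₂ = Lk00 Li01 Lk10⁻¹ Lj10 Li10⁻¹`. -/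
def wG2 (W : GaugeConfig d L SU2) : SU2 :=
  W (b, k) * W (b.shift k, i) * (W (b.shift i, k))⁻¹ * W (b.shift i, j) * (W (b.shift j, i))⁻¹
/-- The equatorial hexagon `H = Li01 Lk10⁻¹ Lj10 Li10⁻¹ Lk01 Lj01⁻¹`. -/
def wH (W : GaugeConfig d L SU2) : SU2 :=
  W (b.shift k, i) * (W (b.shift i, k))⁻¹ * W (b.shift i, j) * (W (b.shift j, i))⁻¹ * W (b.shift j, k) *
    (W (b.shift k, j))⁻¹
/-- `α₃ = Lk01`. -/
def wA3 (W : GaugeConfig d L SU2) : SU2 := W (b.shift j, k)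
/-- `β₃ = Lk11⁻¹ Li10⁻¹`. -/
def wB3 (W : GaugeConfig d L SU2) : SU2 := (W ((b.shift i).shift j, k))⁻¹ * (W (b.shift j, i))⁻¹
/-- `γ₃ = Lj01⁻¹ Li01 Lj11`. -/
def wG3 (W : GaugeConfig d L SU2) : SU2 := (W (b.shift k, j))⁻¹ * W (b.shift k, i) * W ((b.shift i).shift k, j)
/-- `α₄ = Lk01 Lj01⁻¹ Li01`. -/
def wA4 (W : GaugeConfig d L SU2) : SU2 := W (b.shift j, k) * (W (b.shift k, j))⁻¹ * W (b.shift k, i)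
/-- `γ₄ = Lk10⁻¹ Lj10 Lk11`. -/
def wG4 (W : GaugeConfig d L SU2) : SU2 := (W (b.shift i, k))⁻¹ * W (b.shift i, j) * W ((b.shift i).shift j, k)
/-- `α₅ = Lk01 Lj01⁻¹ Li01 Lk10⁻¹`. -/
def wA5 (W : GaugeConfig d L SU2) : SU2 :=
  W (b.shift j, k) * (W (b.shift k, j))⁻¹ * W (b.shift k, i) * (W (b.shift i, k))⁻¹
/-- `β₅ = Li10⁻¹`. -/
def wB5 (W : GaugeConfig d L SU2) : SU2 := (W (b.shift j, i))⁻¹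
/-- `γ₅ = Lk10 Li01⁻¹ Lj01 Lk01⁻¹ Li10`. -/
def wG5 (W : GaugeConfig d L SU2) : SU2 :=
  W (b.shift i, k) * (W (b.shift k, i))⁻¹ * W (b.shift k, j) * (W (b.shift j, k))⁻¹ * W (b.shift j, i)

variable {J c i j k b}

omit [NeZero L] in
/-- The plaquette holonomy does not see a link outside the plaquette. -/
theorem plaquetteHolonomy_update_of_ne (W : GaugeConfig d L SU2) {e : Edge d L} (g : SU2) {x : Site d L}
    {a a' : Fin d} (h1 : (x, a) ≠ e) (h2 : (x.shift a, a') ≠ e) (h3 : (x.shift a', a) ≠ e) (h4 : (x, a') ≠ e) :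
    plaquetteHolonomy (update W e g) x a a' = plaquetteHolonomy W x a a' := by
  simp only [plaquetteHolonomy, update_of_ne h1, update_of_ne h2, update_of_ne h3, update_of_ne h4]

/-- **`Z_cube = 1 + Σ_{n=1}^{J} (n+1)² c_n⁶`** (Tomboulis App. A (A.5); character expansion of a cube = sphere with six
faces). -/
theorem cubeZ_eq [Fact (1 < L)] (hij : i < j) (hjk : j < k) :
    cubeZ J c i j k b hij (hij.trans hjk) hjk = 1 + ∑ n ∈ Icc 1 J, ((n : ℝ) + 1) ^ 2 * c n ^ 6 := by
  have hik : i < k := hij.trans hjk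
  have nij : i ≠ j := hij.ne
  have nji : j ≠ i := hij.ne'
  have nik : i ≠ k := hik.ne
  have nki : k ≠ i := hik.ne'
  have njk : j ≠ k := hjk.ne
  have nkj : k ≠ j := hjk.ne'
  -- distinct sites (all the side conditions "does not depend on the link")
  have s1 := shift_ne_self' b i; have s2 := shift_ne_self' b j; have s3 := shift_ne_self' b k
  have s4 := shift_shift_ne_self' b nkj; have s5 := shift_shift_ne_self' b nki
  have s6 := shift_shift_ne_self' b njk; have s7 := shift_shift_ne_self' b nik
  have s8 := self_ne_shift' (b.shift j) k; have s9 := self_ne_shift' (b.shift i) k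
  have s10 := shift_ne_shift_shift' b j k; have s11 := shift_ne_shift_shift' b i k
  have s12 := shift_ne_shift' b nki
  -- the integrands after each merging
  let μ : Measure (GaugeConfig d L SU2) := Measure.pi fun _ : Edge d L => haarProbability SU2
  let s : ℕ → ℝ := stdCoef c
  let c1 : ℕ → ℝ := fun n => s n * s n / ((n : ℝ) + 1)
  let c2 : ℕ → ℝ := fun n => s n * c1 n / ((n : ℝ) + 1)
  let c2' : ℕ → ℝ := fun n => c1 n * s n / ((n : ℝ) + 1)
  let F2 : GaugeConfig d L SU2 → ℝ := fun W => fR J c (plaqRe rhoFund W (b.shift k, ⟨(i, j), hij⟩))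
  let F4 : GaugeConfig d L SU2 → ℝ := fun W => fR J c (plaqRe rhoFund W (b.shift j, ⟨(i, k), hik⟩))
  let F5 : GaugeConfig d L SU2 → ℝ := fun W => fR J c (plaqRe rhoFund W (b, ⟨(j, k), hjk⟩))
  let F6 : GaugeConfig d L SU2 → ℝ := fun W => fR J c (plaqRe rhoFund W (b.shift i, ⟨(j, k), hjk⟩))
  let P1 : GaugeConfig d L SU2 → ℝ := fun W => F2 W * F4 W * F5 W * F6 W
  let P2 : GaugeConfig d L SU2 → ℝ := fun W => F2 W * F4 W * F6 W
  let P3 : GaugeConfig d L SU2 → ℝ := fun W => faceSum J c2 (wH i j k b W) * F6 W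
  let P4 : GaugeConfig d L SU2 → ℝ := fun W => faceSum J c2 (wH i j k b W)
  -- continuity of the face factors
  have cF : ∀ p : Plaquette d L, Continuous fun W : GaugeConfig d L SU2 => fR J c (plaqRe rhoFund W p) :=
    fun p => (continuous_fR J c).comp (continuous_plaqRe p)
  have cH : Continuous (wH i j k b) := by unfold wH; fun_prop
  -- step 0: the two faces at the link `(b, i)`
  have e0 : ∀ W, cubeFn J c i j k b hij hik hjk W =
      faceSum J s ((fun _ : GaugeConfig d L SU2 => (1 : SU2)) W * W (b, i) * wB1 i j b W) *
        faceSum J s (wG1 i k b W * (W (b, i))⁻¹) * P1 W := by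
    intro W
    have h1 : plaquetteHolonomy W b i j = 1 * W (b, i) * wB1 i j b W := by
      simp only [plaquetteHolonomy, wB1]; group
    have h3 : su2a0 (plaquetteHolonomy W b i k) = su2a0 (wG1 i k b W * (W (b, i))⁻¹) := by
      rw [← su2a0_inv (wG1 i k b W * (W (b, i))⁻¹)]
      congr 1
      simp only [plaquetteHolonomy, wG1]; group
    simp only [cubeFn, fR_eq_faceSum, P1, F2, F4, F5, F6]
    rw [h1, faceSum_congr_su2a0 J s h3]
    ring
  have m1 := integral_faceSum_merge (b, i) J s s (fun _ => 1) (wB1 i j b) (wG1 i k b) P1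
    (fun W g => rfl)
    (fun W g => by simp only [wB1, update_apply, Prod.mk.injEq, nji, s2, and_true, and_false, if_false])
    (fun W g => by simp only [wG1, update_apply, Prod.mk.injEq, nki, s3, and_true, and_false, if_false])
    (fun W g => by
      simp only [P1, F2, F4, F5, F6, plaqRe]
      rw [plaquetteHolonomy_update_of_ne W g (edge_ne_of_site s3 _ _) (edge_ne_of_dir _ _ nji)
          (edge_ne_of_site s4 _ _) (edge_ne_of_dir _ _ nji),
        plaquetteHolonomy_update_of_ne W g (edge_ne_of_site s2 _ _) (edge_ne_of_dir _ _ nki)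
          (edge_ne_of_site s6 _ _) (edge_ne_of_dir _ _ nki),
        plaquetteHolonomy_update_of_ne W g (edge_ne_of_dir _ _ nji) (edge_ne_of_dir _ _ nki)
          (edge_ne_of_dir _ _ nji) (edge_ne_of_dir _ _ nki),
        plaquetteHolonomy_update_of_ne W g (edge_ne_of_dir _ _ nji) (edge_ne_of_dir _ _ nki)
          (edge_ne_of_dir _ _ nji) (edge_ne_of_dir _ _ nki)])
    continuous_const (by unfold wB1; fun_prop) (by unfold wG1; fun_prop)
    ((((cF _).mul (cF _)).mul (cF _)).mul (cF _))
  -- step 1: the hexagon cap around `b` — merge `F5` at the link `(b, j)`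
  have e1 : ∀ W, faceSum J c1 ((fun _ : GaugeConfig d L SU2 => (1 : SU2)) W * wG1 i k b W * wB1 i j b W) * P1 W =
      faceSum J s ((fun _ : GaugeConfig d L SU2 => (1 : SU2)) W * W (b, j) * wB2 j k b W) *
        faceSum J c1 (wG2 i j k b W * (W (b, j))⁻¹) * P2 W := by
    intro W
    have h1 : (1 : SU2) * wG1 i k b W * wB1 i j b W = wG2 i j k b W * (W (b, j))⁻¹ := by
      simp only [wG1, wB1, wG2]; group
    have h5 : plaquetteHolonomy W b j k = 1 * W (b, j) * wB2 j k b W := by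
      simp only [plaquetteHolonomy, wB2]; group
    simp only [P1, P2, F5, fR_eq_faceSum]
    rw [h1, h5]
    ring
  have m2 := integral_faceSum_merge (b, j) J s c1 (fun _ => 1) (wB2 j k b) (wG2 i j k b) P2
    (fun W g => rfl)
    (fun W g => by simp only [wB2, update_apply, Prod.mk.injEq, nkj, s3, and_true, and_false, if_false])
    (fun W g => by simp only [wG2, update_apply, Prod.mk.injEq, nkj, nij, s1, and_true, and_false, if_false])
    (fun W g => by
      simp only [P2, F2, F4, F6, plaqRe]
      rw [plaquetteHolonomy_update_of_ne W g (edge_ne_of_dir _ _ nij) (edge_ne_of_site s5 _ _)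
          (edge_ne_of_dir _ _ nij) (edge_ne_of_site s3 _ _),
        plaquetteHolonomy_update_of_ne W g (edge_ne_of_dir _ _ nij) (edge_ne_of_dir _ _ nkj)
          (edge_ne_of_dir _ _ nij) (edge_ne_of_dir _ _ nkj),
        plaquetteHolonomy_update_of_ne W g (edge_ne_of_site s1 _ _) (edge_ne_of_dir _ _ nkj)
          (edge_ne_of_site s7 _ _) (edge_ne_of_dir _ _ nkj)])
    continuous_const (by unfold wB2; fun_prop) (by unfold wG2; fun_prop) (((cF _).mul (cF _)).mul (cF _))
  -- step 2: the two faces at the link `(b + e_j + e_k, i)`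
  have e2 : ∀ W, faceSum J c2 ((fun _ : GaugeConfig d L SU2 => (1 : SU2)) W * wG2 i j k b W * wB2 j k b W) * P2 W =
      faceSum J s (wA3 j k b W * W ((b.shift j).shift k, i) * wB3 i j k b W) *
        faceSum J s (wG3 i j k b W * (W ((b.shift j).shift k, i))⁻¹) * P3 W := by
    intro W
    have hH : su2a0 ((1 : SU2) * wG2 i j k b W * wB2 j k b W) = su2a0 (wH i j k b W) := by
      rw [← su2a0_conj (W (b, k)) (wH i j k b W)]
      congr 1
      simp only [wG2, wB2, wH]; group
    have h4 : su2a0 (plaquetteHolonomy W (b.shift j) i k) =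
        su2a0 (wA3 j k b W * W ((b.shift j).shift k, i) * wB3 i j k b W) := by
      rw [← su2a0_inv (wA3 j k b W * _ * wB3 i j k b W)]
      congr 1
      simp only [plaquetteHolonomy, wA3, wB3, shift_comm b j i]; group
    have h2 : su2a0 (plaquetteHolonomy W (b.shift k) i j) =
        su2a0 (wG3 i j k b W * (W ((b.shift j).shift k, i))⁻¹) := by
      rw [show plaquetteHolonomy W (b.shift k) i j =
          (W (b.shift k, i) * W ((b.shift i).shift k, j) * (W ((b.shift j).shift k, i))⁻¹) * (W (b.shift k, j))⁻¹ by
            simp only [plaquetteHolonomy, shift_comm b k i, shift_comm b k j],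
        su2a0_mul_comm]
      congr 1
      simp only [wG3]; group
    simp only [P2, P3, F2, F4, fR_eq_faceSum]
    rw [faceSum_congr_su2a0 J c2 hH, faceSum_congr_su2a0 J s h4, faceSum_congr_su2a0 J s h2]
    ring
  have m3 := integral_faceSum_merge ((b.shift j).shift k, i) J s s (wA3 j k b) (wB3 i j k b) (wG3 i j k b) P3
    (fun W g => by simp only [wA3, update_apply, Prod.mk.injEq, nki, and_false, if_false])
    (fun W g => by simp only [wB3, update_apply, Prod.mk.injEq, nki, s8, and_true, and_false, if_false])
    (fun W g => by simp only [wG3, update_apply, Prod.mk.injEq, nji, s10, and_true, and_false, if_false])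
    (fun W g => by
      simp only [P3, F6, plaqRe]
      rw [plaquetteHolonomy_update_of_ne W g (edge_ne_of_dir _ _ nji) (edge_ne_of_dir _ _ nki)
          (edge_ne_of_dir _ _ nji) (edge_ne_of_dir _ _ nki)]
      simp only [wH, update_apply, Prod.mk.injEq, nki, nji, s10, s8, and_true, and_false, if_false])
    (by unfold wA3; fun_prop) (by unfold wB3; fun_prop) (by unfold wG3; fun_prop)
    (((continuous_faceSum J c2).comp cH).mul (cF _))
  -- step 3: the hexagon cap around `b + e_i + e_j + e_k` — merge `F6` at the link `(b + e_i + e_k, j)`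
  have e3 : ∀ W, faceSum J c1 (wA3 j k b W * wG3 i j k b W * wB3 i j k b W) * P3 W =
      faceSum J c1 (wA4 i j k b W * W ((b.shift i).shift k, j) * wB3 i j k b W) *
        faceSum J s (wG4 i j k b W * (W ((b.shift i).shift k, j))⁻¹) * P4 W := by
    intro W
    have h1 : wA3 j k b W * wG3 i j k b W * wB3 i j k b W = wA4 i j k b W * W ((b.shift i).shift k, j) * wB3 i j k b W := by
      simp only [wA3, wG3, wB3, wA4]; group
    have h6 : su2a0 (plaquetteHolonomy W (b.shift i) j k) =
        su2a0 (wG4 i j k b W * (W ((b.shift i).shift k, j))⁻¹) := by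
      rw [show plaquetteHolonomy W (b.shift i) j k =
          (W (b.shift i, j) * W ((b.shift i).shift j, k) * (W ((b.shift i).shift k, j))⁻¹) * (W (b.shift i, k))⁻¹ from rfl,
        su2a0_mul_comm]
      congr 1
      simp only [wG4]; group
    simp only [P3, P4, F6, fR_eq_faceSum]
    rw [h1, faceSum_congr_su2a0 J s h6]
    ring
  have m4 := integral_faceSum_merge ((b.shift i).shift k, j) J c1 s (wA4 i j k b) (wB3 i j k b) (wG4 i j k b) P4
    (fun W g => by simp only [wA4, update_apply, Prod.mk.injEq, nkj, nij, s11, and_true, and_false, if_false])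
    (fun W g => by simp only [wB3, update_apply, Prod.mk.injEq, nkj, nij, and_false, if_false])
    (fun W g => by simp only [wG4, update_apply, Prod.mk.injEq, nkj, s9, and_true, and_false, if_false])
    (fun W g => by
      simp only [P4, wH, update_apply, Prod.mk.injEq, nkj, nij, s9, s11, and_true, and_false, if_false])
    (by unfold wA4; fun_prop) (by unfold wB3; fun_prop) (by unfold wG4; fun_prop) ((continuous_faceSum J c2).comp cH)
  -- step 4: glue the two hexagons at the link `(b + e_i, j)`
  have e4 : ∀ W, faceSum J c2' (wA4 i j k b W * wG4 i j k b W * wB3 i j k b W) * P4 W =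
      faceSum J c2' (wA5 i j k b W * W (b.shift i, j) * wB5 i j b W) *
        faceSum J c2 (wG5 i j k b W * (W (b.shift i, j))⁻¹) * (fun _ : GaugeConfig d L SU2 => (1 : ℝ)) W := by
    intro W
    have h1 : wA4 i j k b W * wG4 i j k b W * wB3 i j k b W = wA5 i j k b W * W (b.shift i, j) * wB5 i j b W := by
      simp only [wA4, wG4, wB3, wA5, wB5]; group
    have hH : su2a0 (wH i j k b W) = su2a0 (wG5 i j k b W * (W (b.shift i, j))⁻¹) := by
      rw [← su2a0_inv (wH i j k b W),
        show (wH i j k b W)⁻¹ = (W (b.shift k, j) * (W (b.shift j, k))⁻¹ * W (b.shift j, i) * (W (b.shift i, j))⁻¹) *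
            (W (b.shift i, k) * (W (b.shift k, i))⁻¹) by simp only [wH]; group,
        su2a0_mul_comm]
      congr 1
      simp only [wG5]; group
    simp only [P4]
    rw [h1, faceSum_congr_su2a0 J c2 hH]
    ring
  have m5 := integral_faceSum_merge (b.shift i, j) J c2' c2 (wA5 i j k b) (wB5 i j b) (wG5 i j k b) (fun _ => 1)
    (fun W g => by simp only [wA5, update_apply, Prod.mk.injEq, nkj, nij, s12, and_true, and_false, if_false])
    (fun W g => by simp only [wB5, update_apply, Prod.mk.injEq, nij, and_false, if_false])
    (fun W g => by simp only [wG5, update_apply, Prod.mk.injEq, nkj, nij, s12, and_true, and_false, if_false])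
    (fun W g => rfl)
    (by unfold wA5; fun_prop) (by unfold wB5; fun_prop) (by unfold wG5; fun_prop) continuous_const
  -- the last word is trivial
  have e5 : ∀ W, faceSum J (fun n => c2' n * c2 n / ((n : ℝ) + 1)) (wA5 i j k b W * wG5 i j k b W * wB5 i j b W) *
      (fun _ : GaugeConfig d L SU2 => (1 : ℝ)) W = ∑ n ∈ Finset.range (J + 1), c2' n * c2 n / ((n : ℝ) + 1) * ((n : ℝ) + 1) := by
    intro W
    have h1 : wA5 i j k b W * wG5 i j k b W * wB5 i j b W = 1 := by
      simp only [wA5, wG5, wB5]; group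
    rw [h1, faceSum_one, mul_one]
  -- assemble
  unfold cubeZ
  rw [integral_congr_ae (ae_of_all _ e0), m1, integral_congr_ae (ae_of_all _ e1), m2,
    integral_congr_ae (ae_of_all _ e2), m3, integral_congr_ae (ae_of_all _ e3), m4,
    integral_congr_ae (ae_of_all _ e4), m5, integral_congr_ae (ae_of_all _ e5), integral_const, probReal_univ,
    one_smul, sum_range_succ_eq_add_sum_Icc]
  have h0 : c2' 0 * c2 0 / (((0 : ℕ) : ℝ) + 1) * (((0 : ℕ) : ℝ) + 1) = 1 := by
    simp [c2', c2, c1, s, stdCoef]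
  rw [h0]
  congr 1
  refine Finset.sum_congr rfl fun n hn => ?_
  have hn0 : n ≠ 0 := by have := (Finset.mem_Icc.1 hn).1; omega
  have hn1 : ((n : ℝ) + 1) ≠ 0 := by positivity
  simp only [c2', c2, c1, s, stdCoef, hn0, ↓reduceIte]
  field_simp

end Cube

end Summit.Ventures.YMGap.Census

end
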